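import Literature.NumberTheory.Transcendental.KZCubeRationalMoves

/-!
# `ReductionRigidity` (stmt-KontsevichZagierPeriods-3407), line `Sketch`, stub `stub_islandComplement`:
# tools for the weight-two growth moves — the REFLECTION move of the cube and face bookkeeping on `□³`

Route `KontsevichZagierPeriods/HermiteRigidity`, crux `ReductionRigidity` (stmt-3407); helper H0 of
`Cruxes/ReductionRigidity/STUB-PLAN-stub_islandComplement.md` and the small evaluation kit used by the
Landen chain (`HermiteRigidityIslandComplementBoxLanden.lean`):

* `stub_reflectAt` (registered sub-goal stub) / `rel_reflect` — **the reflection `xᵢ ↦ 1 − xᵢ` of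
  the closed cube is a relation**: for tame cube representations (resp. regular rational functions
  `T, S`) on `[0,1]ᴹ` with `S(x) = T(x with xᵢ := 1 − xᵢ)` on the cube,
  `[□ᴹ, S] − [□ᴹ, T] ∈ KZ.relations` — ONE change-of-variables generator of `KZ.cubicalCovGens`
  (rule 2; the map is an affine involution of the cube, `|det| = 1` because the derivative is an
  involution), with no side condition; and its `χ`-form `rfun_chi_reflect`;
* `rfun_pd_fn_eq` — the value of a formal partial derivative (quotient rule, unfolded);
* `rfun_chi_of_eq` — an arbitrary representation on `□ᴹ` whose integrand agrees with a regular
  rational function has the same `χ`-value;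
* the nine evaluations of `Fin.insertNth` on `Fin 3` (faces of `□³` along each coordinate).

References: M. Kontsevich, D. Zagier, *Periods* (2001), §1.2 rule (2) [cite: KontsevichZagier2001, §1.2].
No definitions are introduced.
-/

noncomputable section

open MeasureTheory Set MvPolynomial

namespace Summit.KontsevichZagierPeriods.HermiteRigidity.ReductionRigidity

open Literature.NumberTheory.Transcendental
open Literature.NumberTheory.Transcendental.KZ
open Literature.ModelTheory.ExponentialFields (IsSemialgebraic)

/-! ## The reflection move -/

/-- The reflection `x ↦ (x with xᵢ := 1 − xᵢ)` is an involution. [folklore] -/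
theorem reflect_reflect {M : ℕ} (i : Fin M) (x : Fin M → ℝ) :
    Function.update (Function.update x i (1 - x i)) i
        (1 - Function.update x i (1 - x i) i) = x := by
  funext j
  rcases eq_or_ne j i with rfl | hj
  · simp
  · simp [Function.update_of_ne hj]

/-- The reflection maps the closed cube onto itself. [folklore] -/
theorem image_reflect_cube {M : ℕ} (i : Fin M) :
    (fun x : Fin M → ℝ => Function.update x i (1 - x i)) '' cube M = cube M := by
  refine Subset.antisymm ?_ fun y hy => ?_
  · rintro _ ⟨x, hx, rfl⟩
    exact KZ.update_mem_cube hx i (by linarith [(hx i).2]) (by linarith [(hx i).1])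
  · refine ⟨Function.update y i (1 - y i),
      KZ.update_mem_cube hy i (by linarith [(hy i).2]) (by linarith [(hy i).1]), ?_⟩
    exact reflect_reflect i y

/-- The derivative of the reflection, `v ↦ (v with vᵢ := −vᵢ)`, written as
`id − (2·projᵢ) ⊗ eᵢ`; its values. [folklore] -/
theorem reflectDeriv_apply {M : ℕ} (i : Fin M) (v : Fin M → ℝ) (j : Fin M) :
    ((ContinuousLinearMap.id ℝ (Fin M → ℝ) -
        ((2:ℝ) • ContinuousLinearMap.proj (R := ℝ) (φ := fun _ : Fin M => ℝ) i).smulRight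
          (Pi.single i (1:ℝ) : Fin M → ℝ) : (Fin M → ℝ) →L[ℝ] (Fin M → ℝ))) v j = if j = i then -v i else v j := by
  simp only [sub_apply, ContinuousLinearMap.id_apply, ContinuousLinearMap.smulRight_apply,
    smul_apply, ContinuousLinearMap.proj_apply, Pi.sub_apply, Pi.smul_apply, smul_eq_mul,
    Pi.single_apply, mul_ite, mul_one, mul_zero]
  split_ifs with hj
  · subst hj; ring
  · ring

/-- The derivative of the reflection has `|det| = 1` (it is an involution). [folklore] -/
theorem abs_det_reflectDeriv {M : ℕ} (i : Fin M) :
    |((ContinuousLinearMap.id ℝ (Fin M → ℝ) -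
        ((2:ℝ) • ContinuousLinearMap.proj (R := ℝ) (φ := fun _ : Fin M => ℝ) i).smulRight
          (Pi.single i (1:ℝ) : Fin M → ℝ) : (Fin M → ℝ) →L[ℝ] (Fin M → ℝ))).det| = 1 := by
  set L := (ContinuousLinearMap.id ℝ (Fin M → ℝ) -
    ((2:ℝ) • ContinuousLinearMap.proj (R := ℝ) (φ := fun _ : Fin M => ℝ) i).smulRight
      (Pi.single i (1:ℝ) : Fin M → ℝ) : (Fin M → ℝ) →L[ℝ] (Fin M → ℝ)) with hL
  have hinv : (L : (Fin M → ℝ) →ₗ[ℝ] (Fin M → ℝ)).comp (L : (Fin M → ℝ) →ₗ[ℝ] (Fin M → ℝ)) =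
      LinearMap.id := by
    refine LinearMap.ext fun v => funext fun j => ?_
    rw [LinearMap.comp_apply, ContinuousLinearMap.coe_coe, LinearMap.id_apply, hL,
      reflectDeriv_apply, reflectDeriv_apply]
    rcases eq_or_ne j i with rfl | hj
    · simp
    · simp [hj]
  have h := congrArg LinearMap.det hinv
  rw [LinearMap.det_comp, LinearMap.det_id] at h
  rw [ContinuousLinearMap.det]
  rcases mul_self_eq_one_iff.mp h with h1 | h1 <;> simp [h1]

/-- The reflection has the derivative above at every point. [folklore] -/
theorem hasFDerivAt_reflect {M : ℕ} (i : Fin M) (x : Fin M → ℝ) :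
    HasFDerivAt (fun y : Fin M → ℝ => Function.update y i (1 - y i))
      ((ContinuousLinearMap.id ℝ (Fin M → ℝ) -
        ((2:ℝ) • ContinuousLinearMap.proj (R := ℝ) (φ := fun _ : Fin M => ℝ) i).smulRight
          (Pi.single i (1:ℝ) : Fin M → ℝ) : (Fin M → ℝ) →L[ℝ] (Fin M → ℝ))) x := by
  have h0 : HasFDerivAt (fun y : Fin M → ℝ => 2 * y i - 1)
      ((2:ℝ) • ContinuousLinearMap.proj (R := ℝ) (φ := fun _ : Fin M => ℝ) i) x :=
    ((hasFDerivAt_apply i x).const_mul (2:ℝ)).sub_const 1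
  have h1 := (hasFDerivAt_id x).sub (h0.smul_const (Pi.single i (1:ℝ)))
  refine h1.congr_of_eventuallyEq (Filter.Eventually.of_forall fun y => ?_)
  funext j
  simp only [Pi.sub_apply, id_eq, Pi.smul_apply, Pi.single_apply, smul_eq_mul, mul_ite, mul_one,
    mul_zero, Function.update_apply]
  split_ifs with hj
  · subst hj; ring
  · ring

/-- The reflection is a `ℚ`-semialgebraic map on the cube (it is polynomial). [cite: BochnakCosteRoy1998, §2.2] -/
theorem isSemialgebraicMapOn_reflect {M : ℕ} (i : Fin M) :
    IsSemialgebraicMapOn ℚ (cube M) (fun y : Fin M → ℝ => Function.update y i (1 - y i)) := by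
  refine (isSemialgebraicMapOn_aeval isSemialgebraic_cube
    (Function.update (fun j => (X j : MvPolynomial (Fin M) ℚ)) i (1 - X i))).congr fun x _ => ?_
  funext j
  rcases eq_or_ne j i with rfl | hj
  · simp
  · simp [Function.update_of_ne hj]

/-- **Stub `stub_reflectAt`** (helper H0 of the stub plan, registered on the crux): **the reflection
move for tame cube representations.** For tame cube representations `r, r'` on `[0,1]ⁿ` with
`r(x) = r'(x with xᵢ := 1 − xᵢ)` on the cube, `[r] − [r'] ∈ KZ.relations` — one generator of
`KZ.cubicalCovGens` along the affine involution `xᵢ ↦ 1 − xᵢ` of the cube (`|det| = 1`).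
[cite: KontsevichZagier2001, §1.2 rule (2)] -/
theorem stub_reflectAt :
    ∀ (n : ℕ) (i : Fin n) (r r' : IntegralRep n), r.IsTameCube → r'.IsTameCube →
      (∀ x ∈ cube n, r.integrand x = r'.integrand (Function.update x i (1 - x i))) →
      KZ.of r - KZ.of r' ∈ KZ.relations := by
  intro M i r r' hr hr' h
  refine cubicalCovGens_subset_relations (mem_cubicalCovGens hr hr'
    (Φ := fun y : Fin M → ℝ => Function.update y i (1 - y i))
    (Φ' := fun _ => (ContinuousLinearMap.id ℝ (Fin M → ℝ) -
        ((2:ℝ) • ContinuousLinearMap.proj (R := ℝ) (φ := fun _ : Fin M => ℝ) i).smulRight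
          (Pi.single i (1:ℝ) : Fin M → ℝ) : (Fin M → ℝ) →L[ℝ] (Fin M → ℝ)))
    (isSemialgebraicMapOn_reflect i) (fun x _ => (hasFDerivAt_reflect i x).hasFDerivWithinAt)
    (fun x _ y _ hxy => ?_) (image_reflect_cube i) (fun j => ?_) fun x hx => ?_)
  · have hx := reflect_reflect i x
    have hy := reflect_reflect i y
    simp only at hxy
    rw [← hx, ← hy, hxy]
  · rcases eq_or_ne j i with rfl | hj
    · simp only [Function.update_self]
      exact fun x _ => analyticAt_const.sub
        ((ContinuousLinearMap.proj (R := ℝ) (φ := fun _ : Fin M => ℝ) j).analyticAt x)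
    · simp only [Function.update_of_ne hj]
      exact fun x _ => (ContinuousLinearMap.proj (R := ℝ) (φ := fun _ : Fin M => ℝ) j).analyticAt x
  · rw [abs_det_reflectDeriv, mul_one]
    exact h x hx

/-- **The reflection move for regular rational functions**: for `T, S : KZ.RFun M` with
`S(x) = T(x with xᵢ := 1 − xᵢ)` on the cube, `[□ᴹ, S] − [□ᴹ, T] ∈ KZ.relations` (no side
condition). [cite: KontsevichZagier2001, §1.2 rule (2)] -/
theorem rel_reflect {M : ℕ} (i : Fin M) (T S : RFun M)
    (h : ∀ x ∈ cube M, S.fn x = T.fn (Function.update x i (1 - x i))) :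
    KZ.of S.rep - KZ.of T.rep ∈ KZ.relations :=
  stub_reflectAt M i S.rep T.rep S.isTameCube_rep T.isTameCube_rep h

/-! ## Values of formal partial derivatives; `χ`-forms -/

/-- The value of the formal partial derivative `T.pd i` (quotient rule, unfolded). [folklore] -/
theorem rfun_pd_fn_eq {M : ℕ} (T : RFun M)
    (i : Fin M) (p : Fin M → ℝ) :
    (T.pd i).fn p = (aeval p (pderiv i T.num) * aeval p T.den -
      aeval p T.num * aeval p (pderiv i T.den)) / aeval p T.den ^ 2 := by
  simp only [RFun.fn, RFun.pd, map_sub, map_mul, map_pow]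

section Chi

variable {R : Type} [CommRing R] {χ : KZ.FormalRep →+ R}
variable (hrel : ∀ c ∈ KZ.relations, χ c = 0)
include hrel

/-- A representation on `□ᴹ` whose integrand agrees with a regular rational function `T` on the cube
has the `χ`-value `⟪T⟫` (congruence, rule 1b). [cite: KontsevichZagier2001, §1.2 rule (1)] -/
theorem rfun_chi_of_eq {M : ℕ} {r : IntegralRep M}
    (T : RFun M) (hr : r.domain = cube M) (h : ∀ x ∈ cube M, r.integrand x = T.fn x) :
    χ (KZ.of r) = T.chi χ :=
  sub_eq_zero.1 (by
    rw [RFun.chi, ← map_sub]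
    exact hrel _ (KZ.of_sub_of_mem_relations_of_eqOn (by rw [hr]; rfl) fun x hx => by
      rw [hr] at hx; exact h x hx))

/-- `χ`-form of the reflection move: `⟪S⟫ = ⟪T⟫` when `S(x) = T(x with xᵢ := 1 − xᵢ)` on the cube.
[cite: KontsevichZagier2001, §1.2 rule (2)] -/
theorem rfun_chi_reflect {M : ℕ} (i : Fin M)
    (T S : RFun M) (h : ∀ x ∈ cube M, S.fn x = T.fn (Function.update x i (1 - x i))) :
    S.chi χ = T.chi χ :=
  sub_eq_zero.1 (by rw [RFun.chi, RFun.chi, ← map_sub]; exact hrel _ (rel_reflect i T S h))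

end Chi

/-! ## Faces of `□³`: evaluating `Fin.insertNth` on `Fin 3` -/

/-- Face `x₀ = c` of `□³`: the inserted coordinate. [folklore] -/
theorem insertNth_zero_apply_zero (c : ℝ) (x : Fin 2 → ℝ) :
    (Fin.insertNth (0 : Fin 3) c x : Fin 3 → ℝ) 0 = c := by
  rw [Fin.insertNth_apply_same]

/-- Face `x₀ = c` of `□³`: coordinate `1` reads `x 0`. [folklore] -/
theorem insertNth_zero_apply_one (c : ℝ) (x : Fin 2 → ℝ) :
    (Fin.insertNth (0 : Fin 3) c x : Fin 3 → ℝ) 1 = x 0 := by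
  rw [show (1 : Fin 3) = (0 : Fin 3).succAbove 0 from rfl, Fin.insertNth_apply_succAbove]

/-- Face `x₀ = c` of `□³`: coordinate `2` reads `x 1`. [folklore] -/
theorem insertNth_zero_apply_two (c : ℝ) (x : Fin 2 → ℝ) :
    (Fin.insertNth (0 : Fin 3) c x : Fin 3 → ℝ) 2 = x 1 := by
  rw [show (2 : Fin 3) = (0 : Fin 3).succAbove 1 from rfl, Fin.insertNth_apply_succAbove]

/-- Face `x₁ = c` of `□³`: coordinate `0` reads `x 0`. [folklore] -/
theorem insertNth_one_apply_zero (c : ℝ) (x : Fin 2 → ℝ) :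
    (Fin.insertNth (1 : Fin 3) c x : Fin 3 → ℝ) 0 = x 0 := by
  rw [show (0 : Fin 3) = (1 : Fin 3).succAbove 0 from rfl, Fin.insertNth_apply_succAbove]

/-- Face `x₁ = c` of `□³`: the inserted coordinate. [folklore] -/
theorem insertNth_one_apply_one (c : ℝ) (x : Fin 2 → ℝ) :
    (Fin.insertNth (1 : Fin 3) c x : Fin 3 → ℝ) 1 = c := by
  rw [Fin.insertNth_apply_same]

/-- Face `x₁ = c` of `□³`: coordinate `2` reads `x 1`. [folklore] -/
theorem insertNth_one_apply_two (c : ℝ) (x : Fin 2 → ℝ) :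
    (Fin.insertNth (1 : Fin 3) c x : Fin 3 → ℝ) 2 = x 1 := by
  rw [show (2 : Fin 3) = (1 : Fin 3).succAbove 1 from rfl, Fin.insertNth_apply_succAbove]

/-- Face `x₂ = c` of `□³`: coordinate `0` reads `x 0`. [folklore] -/
theorem insertNth_two_apply_zero (c : ℝ) (x : Fin 2 → ℝ) :
    (Fin.insertNth (2 : Fin 3) c x : Fin 3 → ℝ) 0 = x 0 := by
  rw [show (0 : Fin 3) = (2 : Fin 3).succAbove 0 from rfl, Fin.insertNth_apply_succAbove]

/-- Face `x₂ = c` of `□³`: coordinate `1` reads `x 1`. [folklore] -/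
theorem insertNth_two_apply_one (c : ℝ) (x : Fin 2 → ℝ) :
    (Fin.insertNth (2 : Fin 3) c x : Fin 3 → ℝ) 1 = x 1 := by
  rw [show (1 : Fin 3) = (2 : Fin 3).succAbove 1 from rfl, Fin.insertNth_apply_succAbove]

/-- Face `x₂ = c` of `□³`: the inserted coordinate. [folklore] -/
theorem insertNth_two_apply_two (c : ℝ) (x : Fin 2 → ℝ) :
    (Fin.insertNth (2 : Fin 3) c x : Fin 3 → ℝ) 2 = c := by
  rw [Fin.insertNth_apply_same]

end Summit.KontsevichZagierPeriods.HermiteRigidity.ReductionRigidity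

end
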